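import Summits.QuantumFields.BalabanUV.Beta.EriceFlowEnclosureB12AsPrintedHistoryNonuniqueRuns
import Summits.QuantumFields.BalabanUV.Beta.EriceFlowEnclosureB12AsPrintedHistoryUniformDepth

/-!
# Beta / EriceFlowEnclosureB12AsPrintedHistoryNonuniqueEnd — FADING MEMORY IS LOAD-BEARING: under a UNIFORM history modulus (θ = 1), with
# every other letter of the cell's uniqueness theorems in force (AF `BetaLowerH b`, `BetaUpperH`, (C) `BetaContH`, even the wall letter
# `BetaPertH β b`), and for EVERY choice of the constants, there are two DISTINCT bare couplings whose runs of the same depth stay in the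
# interval and end at the SAME renormalized coupling — «g₀ = g₀(ε, g)» is NOT a function at large depth (β-flow team, prover 1 = recursion ∕
# upper ∕ bare-coupling ∕ UNIQUENESS side, unit `b2b-balaban-beta-bflow-p1`, gen 34; ROW AP-I·C × ROW U; the END of the witness whose parts are
# `…HistoryNonunique` (letters) and `…HistoryNonuniqueRuns` (runs); POSITIVE companions #61e `…HistoryUnique` (θ < 1: every depth) and
# #62a `…HistoryUniformDepth` (θ = 1: up to depth ≍ b³∕C²))

HONEST FRAMING (page 1 of everything the β sub-cell writes): discharging `BetaPertH` makes Bałaban's UV stability UNCONDITIONAL — a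
real constructive-QFT result; it is NOT the continuum limit and NOT the Clay problem.  HONEST DEPENDENCY (cell reorg 2026-08-19,
verbatim): «continuum YM on T⁴ ⇐ BetaPertH ∧ nine spine estimates (0/9 proved); BetaPertH ⇐ (D1) ∧ (D4) ∧ CAP+tail; G-an2-4 gates
asym, D1 and NE2/3/4.»  THIS MODULE DISCHARGES NOTHING: it assembles ONE TOY FAMILY OF OURS (the bump family of `…HistoryNonunique`, a
[folklore] object, χ ≡ 1) into existence statements.  The letters are the cell's HYPOTHESIS SHAPES — node U2's `T4CouplingMatching.HistLipschitz`
∕ `FadingMemory` (at θ = 1: a UNIFORM modulus, the tree's `BetaDerivClause.CoordLipschitzAt` ∕ `histLipschitz_of_coordLipschitz`), `FlowStep.BetaLowerH`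
∕ `BetaUpperH` ∕ `BetaContH` ∕ `BetaPertH` —, NONE printed in [I] = T. Bałaban, Commun. Math. Phys. **109** (1987) [Balaban1987RG1]: p. 298 says
only that β_j *"depends also on all preceding coupling constants"* (custodian's DELTA-I D-20, 2026-08-27: NO regularity ∕ modulus in the
preceding couplings is printed for the cut-off (2.9)); Theorem 2 (*"there exists a bare coupling constant g₀ = g₀(ε, g)"*, p. 259) is STATED
WITHOUT PROOF.  Nothing of Bałaban's β is asserted; no toy is claimed to resemble the construction.

THE VERDICT OF GEN 34 (rows AP-I·C × U).  In the history reading of [I], «g₀ = g₀(ε, g)» is a FUNCTION at EVERY depth under fading-memory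
moduli Λ k i ≤ Cθ^{k−i}, θ < 1 (#61e), or a last-only ∕ Markov modulus (#61e, row U #22); under a UNIFORM modulus (θ = 1, one constant C for
every age k − i) it is a function UP TO depth K ≍ b³∕C² (#62a `runs_eq_of_uniformModulus`) and — THIS FILE — NOT BEYOND: for every b > 0 (AF
letter), every C > 0 (uniform modulus), every amplitude a > 0 (upper letter b + a), every C_p > 0 (the constant of `BetaPertH`), every box γ
and every renormalized coupling g ∈ ]0, γ] there is a history-dependent β with ALL these letters and two runs of the same depth K = 2n from
DIFFERENT bare couplings, inside ]0, g], both ending at g (`exists_twoRuns_uniformModulus`; n = ⌈1∕g² + 4(2b + 2)³∕C²⌉ + 1, so K ≍ b³∕C² for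
g not too small — #62a's depth scale is sharp in order).  Hence (§21) #61e's `runs_eq_of_fadingMemory` READ AT θ = 1 — its smallness
`C·U ≤ (1 − θ)∕2` then forces C = 0 — admits NO repair by any smallness condition met by some C > 0 (`uniformModulus_twoRuns_setting`:
the hypotheses of §11 at θ = 1 on a `Setting`, conclusion false), and #62a's depth condition cannot be dropped (`not_runs_eq_uniform_allDepths`).
So FADING MEMORY (or Markov-type feedback) is the located, UNPRINTED structural input that makes Theorem 2's function notation honest
uniformly in the cut-off ε = L^{−K}; a uniform coordinatewise modulus — the reading closest to p. 264's *"uniformly bounded … together with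
all derivatives"* transported to the preceding couplings — is NOT enough.  (For every toy here THEOREM 2 AS PRINTED HOLDS — existence, by
#60a `theorem2Statement_of_letters` from (C) + the AF letters; what fails is the UNIQUENESS print does not assert: no Theorem-2 counterexample.)

WHAT THIS FILE PROVES (0 sorry, 0 def):
§20 `lastVar_const_of_bumpFamily` (χ ≡ 1: β_{j+1} does not depend on p_j — row I1's `LastVarLipschitz β 0 γ` holds with constant 0),
    `coordLipschitzAt_of_uniformModulus` (uniform modulus ⟹ the tree's `CoordLipschitzAt` clause), `depth_choice` (the arithmetic of n), **`exists_twoRuns_uniformModulus`** (THE WITNESS with prescribed constants b, C, a, C_p, γ, g).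
§21 **`uniformModulus_twoRuns_setting`** (∃ S : Setting carrying the witness: §11's hypotheses at θ = 1 ∧ g₀ ≠ g₀′),
    **`not_runs_eq_uniform_allDepths`** (#62a's `runs_eq_of_uniformModulus` WITHOUT its depth condition is FALSE).
NOT CLAIMED: anything about Bałaban's β; Theorem 2; `BetaPertH` for Bałaban's β; that Bałaban's β lacks fading memory; continuum; Clay.
-/

namespace Summit.QuantumFields.BalabanUV.Beta.EriceFlowEnclosureB12AsPrintedHistoryNonuniqueEnd

open Finset
open Literature.MathematicalPhysics.QuantumFieldTheory.Balaban1983to89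
open Literature.MathematicalPhysics.QuantumFieldTheory.Balaban1983to89.B12BetaAsPrinted
open Literature.MathematicalPhysics.QuantumFieldTheory.Balaban1983to89.FlowStep (HBeta prefixOf Box mem_box box_mono RGEqH BetaLowerH
  BetaUpperH BetaContH BetaPertH)
open Literature.MathematicalPhysics.QuantumFieldTheory.Balaban1983to89.T4CouplingMatching (HistLipschitz FadingMemory)
open Summit.QuantumFields.BalabanUV.Beta.EriceFlowEnclosureB12AsPrintedHistoryNonunique
open Summit.QuantumFields.BalabanUV.Beta.EriceFlowEnclosureB12AsPrintedHistoryNonuniqueRuns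

noncomputable section

/-! ## §20 The witness with prescribed constants -/

/-- With χ ≡ 1 the family does not depend on the LAST coupling at all (the bump reads only p₀, …, p_{n−1}, and n ≤ j on the band): row I1's
k-uniform last-variable letter `BetaDerivClause.LastVarLipschitz β 0 γ` holds with constant ZERO — last-variable regularity, the only
regularity [I] prints (p. 264), is idle in the uniqueness question. [cite: Balaban1987RG1, §1 p.264 (β-clause after (1.22)) with p.298] -/
theorem lastVar_const_of_bumpFamily {β : HBeta} {b ε M : ℝ} {n : ℕ} {gB : ℕ → ℝ}
    (hβ : ∀ (j : ℕ) (p : Fin (j + 1) → ℝ), β j p = b + (if n ≤ j ∧ j < 2 * n then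
      ε * max (1 - |∑ i : Fin (j + 1), (if (i : ℕ) < n then p i - gB i else 0)| / M) 0 * (fun _ : ℝ => (1 : ℝ)) (p (Fin.last j)) else 0))
    (γ : ℝ) : BetaDerivClause.LastVarLipschitz β 0 γ := by
  intro k p _ s t _ _
  rw [hβ, hβ, zero_mul]
  have hs : ∀ u : ℝ, ∑ i : Fin (k + 1), (if (i : ℕ) < n then Function.update p (Fin.last k) u i - gB i else 0)
      = ∑ i : Fin (k + 1), (if (i : ℕ) < n then p i - gB i else 0) ∨ ¬(n ≤ k ∧ k < 2 * n) := by
    intro u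
    by_cases hband : n ≤ k ∧ k < 2 * n
    · left
      refine Finset.sum_congr rfl fun i _ => ?_
      split_ifs with hi
      · have hne : i ≠ Fin.last k := by
          intro h; rw [h, Fin.val_last] at hi; omega
        rw [Function.update_of_ne hne]
      · rfl
    · right; exact hband
  by_cases hband : n ≤ k ∧ k < 2 * n
  · rcases hs t with ht | ht
    · rcases hs s with hs' | hs'
      · rw [ht, hs', sub_self, abs_zero]
      · exact absurd hband hs'
    · exact absurd hband ht
  · rw [if_neg hband, if_neg hband, sub_self, abs_zero]

/-- **A uniform modulus IS the tree's uniform coordinatewise clause**: `HistLipschitz Λ γ β` with `FadingMemory C 1 Λ` (0 ≤ Λ k i ≤ C) gives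
`BetaDerivClause.CoordLipschitzAt β k C γ` at every scale (change one coupling: only its modulus enters) — the converse of node U2's
`histLipschitz_of_coordLipschitz`; recorded so that the witness below defeats #61e's docstring clause verbatim. [folklore] -/
theorem coordLipschitzAt_of_uniformModulus {β : HBeta} {Λ : ℕ → ℕ → ℝ} {C γ : ℝ} (hL : HistLipschitz Λ γ β) (hΛ : FadingMemory C 1 Λ)
    (k : ℕ) : BetaDerivClause.CoordLipschitzAt β k C γ := by
  intro p hp i t ht0 htγ
  have hq : Function.update p i t ∈ Box γ k := by
    refine mem_box.mpr fun j => ?_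
    by_cases hji : j = i
    · subst hji; rw [Function.update_self]; exact ⟨ht0, htγ⟩
    · rw [Function.update_of_ne hji]; exact mem_box.mp hp j
  have h := hL k (Function.update p i t) p hq hp
  have hsum : ∑ j : Fin (k + 1), Λ k j * |Function.update p i t j - p j| = Λ k i * |t - p i| := by
    rw [Finset.sum_eq_single i]
    · rw [Function.update_self]
    · intro j _ hji; rw [Function.update_of_ne hji, sub_self, abs_zero, mul_zero]
    · intro hi; exact absurd (Finset.mem_univ i) hi
  rw [hsum] at h
  have hC : Λ k i ≤ C := by have := (hΛ k i (Nat.lt_succ_iff.mp i.isLt)).2; simpa using this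
  exact h.trans (mul_le_mul_of_nonneg_right hC (abs_nonneg _))

/-- **The depth arithmetic**: for n ≥ 1∕g², n ≥ 4(2b + 2)³∕C², n ≥ 1 and 0 ≤ Δ ≤ 1 (b ≥ 0, C > 0, g > 0), with x₀ := 1∕g² + b·(2n):
`2(x₀ + Δ)√(x₀ + Δ) ≤ C·n²` — so that ε∕M ≤ C by `M_ge`. [folklore] -/
theorem depth_choice {b C g Δ : ℝ} {n : ℕ} (hb : 0 ≤ b) (hC : 0 < C) (hg : 0 < g) (hΔ0 : 0 ≤ Δ) (hΔ1 : Δ ≤ 1)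
    (hn1 : 1 ≤ (n : ℝ)) (hng : 1 / g ^ 2 ≤ n) (hnC : 4 * (2 * b + 2) ^ 3 / C ^ 2 ≤ n) :
    2 * (1 / g ^ 2 + b * (2 * n) + Δ) * Real.sqrt (1 / g ^ 2 + b * (2 * n) + Δ) ≤ C * (n : ℝ) ^ 2 := by
  set c : ℝ := 2 * b + 2 with hc
  have hc0 : 0 < c := by rw [hc]; linarith
  have hn0 : 0 < (n : ℝ) := by linarith
  set y : ℝ := 1 / g ^ 2 + b * (2 * n) + Δ with hy
  have hy0 : 0 ≤ y := by rw [hy]; positivity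
  have hyc : y ≤ c * n := by rw [hy, hc]; nlinarith
  -- √(c n) ≤ C n ∕ (2c): square both sides, 4c³ ≤ C² n
  have hkey : 2 * c * Real.sqrt (c * n) ≤ C * n := by
    have h4 : 4 * c ^ 3 ≤ C ^ 2 * n := by
      have := hnC; rw [div_le_iff₀ (pow_pos hC 2)] at this; linarith
    have hs : Real.sqrt (c * n) ≤ C * n / (2 * c) := by
      rw [Real.sqrt_le_left (by positivity)]
      rw [div_pow, le_div_iff₀ (by positivity)]
      nlinarith [hn0, hc0]
    calc 2 * c * Real.sqrt (c * n) ≤ 2 * c * (C * n / (2 * c)) := mul_le_mul_of_nonneg_left hs (by positivity)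
      _ = C * n := by field_simp
  calc 2 * y * Real.sqrt y ≤ 2 * (c * n) * Real.sqrt (c * n) :=
        mul_le_mul (mul_le_mul_of_nonneg_left hyc (by norm_num)) (Real.sqrt_le_sqrt hyc) (Real.sqrt_nonneg _) (by positivity)
    _ = (2 * c * Real.sqrt (c * n)) * n := by ring
    _ ≤ (C * n) * n := mul_le_mul_of_nonneg_right hkey hn0.le
    _ = C * (n : ℝ) ^ 2 := by ring

/-- **THE WITNESS WITH PRESCRIBED CONSTANTS.**  For every b > 0 (AF lower letter), C > 0 (uniform history modulus), a > 0 (amplitude of the upper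
letter), C_p > 0 (constant of `BetaPertH`), box γ > 0 and renormalized coupling g ∈ ]0, γ]: there are a history-dependent family β, moduli Λ, a
depth K = 2n and two coupling sequences gᴬ, gᴮ such that — `BetaLowerH b γ′ β` and `BetaUpperH (b + a) γ′ β` on EVERY box; `HistLipschitz Λ γ′ β` on every
box with `FadingMemory C 1 Λ` (uniform, constant C) — equivalently the tree's `BetaDerivClause.CoordLipschitzAt β k C γ′` at every k —; (C) `BetaContH γ′ β`;
`BetaPertH β b` with constant C_p (window γ); row I1's letter with constant 0 — AND gᴬ, gᴮ BOTH solve (0.20) for β up to K (`RGEqH`), stay in ]0, g] ⊆ ]0, γ], END AT g_K = g, and START at DIFFERENT bare couplings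
gᴮ_0 < gᴬ_0.  (The bump family of `…HistoryNonunique` with χ ≡ 1, n = ⌈1∕g² + 4(2b + 2)³∕C²⌉₊ + 1, ε = min(a, 1∕n, C_p g²∕(9(1 + 2bn g²))·…) — all
smallness taken in Δ = nε, the modulus condition by `depth_choice`.) [folklore] -/
theorem exists_twoRuns_uniformModulus {b C a Cp γ g : ℝ} (hb : 0 < b) (hC : 0 < C) (ha : 0 < a) (hCp : 0 < Cp)
    (hγ : 0 < γ) (hg : 0 < g) (hgγ : g ≤ γ) :
    ∃ (β : HBeta) (Λ : ℕ → ℕ → ℝ) (K : ℕ) (gA gB : ℕ → ℝ),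
      (∀ γ', BetaLowerH b γ' β) ∧ (∀ γ', BetaUpperH (b + a) γ' β) ∧ (∀ γ', HistLipschitz Λ γ' β) ∧ FadingMemory C 1 Λ ∧
      (∀ γ' k, BetaDerivClause.CoordLipschitzAt β k C γ') ∧
      (∀ γ', BetaContH γ' β) ∧ BetaPertH β b ∧ (∀ γ', BetaDerivClause.LastVarLipschitz β 0 γ') ∧
      RGEqH K β gA ∧ RGEqH K β gB ∧
      (∀ i, i ≤ K → 0 < gA i ∧ gA i ≤ g) ∧ (∀ i, i ≤ K → 0 < gB i ∧ gB i ≤ g) ∧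
      gA K = g ∧ gB K = g ∧ gB 0 < gA 0 ∧ g ≤ γ := by
  -- the depth
  obtain ⟨n, hn⟩ : ∃ n : ℕ, 1 / g ^ 2 + 4 * (2 * b + 2) ^ 3 / C ^ 2 + 1 ≤ n := exists_nat_ge _
  have hq0 : 0 ≤ 4 * (2 * b + 2) ^ 3 / C ^ 2 := by positivity
  have hg2 : 0 < 1 / g ^ 2 := by positivity
  have hn1 : 1 ≤ (n : ℝ) := by linarith
  have hn1' : 1 ≤ n := by exact_mod_cast hn1
  have hn0 : 0 < (n : ℝ) := by linarith
  have hng : 1 / g ^ 2 ≤ n := by linarith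
  have hnC : 4 * (2 * b + 2) ^ 3 / C ^ 2 ≤ n := by linarith
  -- the free run's starting point and the amplitude
  set x₀ : ℝ := 1 / g ^ 2 + b * (2 * n) with hx₀
  have hx : b * (2 * n) < x₀ := by rw [hx₀]; linarith
  have hx₀0 : 0 < x₀ := by rw [hx₀]; positivity
  set ε : ℝ := min (min a (1 / n)) (min (Cp / (9 * x₀)) (1 / (g ^ 2 * n))) with hεdef
  have hε0 : 0 < ε := by rw [hεdef]; positivity
  have hεa : ε ≤ a := (min_le_left _ _).trans (min_le_left _ _)
  have hεn : ε ≤ 1 / n := (min_le_left _ _).trans (min_le_right _ _)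
  have hεCp : ε ≤ Cp / (9 * x₀) := (min_le_right _ _).trans (min_le_left _ _)
  have hεg : ε ≤ 1 / (g ^ 2 * n) := (min_le_right _ _).trans (min_le_right _ _)
  have hΔ1 : ε * n ≤ 1 := by
    calc ε * n ≤ 1 / n * n := mul_le_mul_of_nonneg_right hεn hn0.le
      _ = 1 := by field_simp
  -- the runs
  set gA : ℕ → ℝ := fun i => 1 / Real.sqrt (x₀ - b * i) with hgA
  set gB : ℕ → ℝ := fun i => 1 / Real.sqrt (x₀ - b * i + ε * ((n - (i - n) : ℕ) : ℝ)) with hgB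
  have hA : ∀ i, gA i = 1 / Real.sqrt (x₀ - b * i) := fun i => rfl
  have hB : ∀ i, gB i = 1 / Real.sqrt (x₀ - b * i + ε * ((n - (i - n) : ℕ) : ℝ)) := fun i => rfl
  set M : ℝ := ∑ i ∈ range n, (gA i - gB i) with hM
  have hMpos : 0 < M := M_pos hA hB hb.le hε0 hx hn1'
  -- the family, χ ≡ 1
  set β : HBeta := fun j p => b + (if n ≤ j ∧ j < 2 * n then
      ε * max (1 - |∑ i : Fin (j + 1), (if (i : ℕ) < n then p i - gB i else 0)| / M) 0 * (fun _ : ℝ => (1 : ℝ)) (p (Fin.last j))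
    else 0) with hβdef
  have hβ : ∀ (j : ℕ) (p : Fin (j + 1) → ℝ), β j p = b + (if n ≤ j ∧ j < 2 * n then
      ε * max (1 - |∑ i : Fin (j + 1), (if (i : ℕ) < n then p i - gB i else 0)| / M) 0 * (fun _ : ℝ => (1 : ℝ)) (p (Fin.last j))
    else 0) := fun j p => rfl
  have hχ : ∀ s : ℝ, 0 ≤ (fun _ : ℝ => (1 : ℝ)) s ∧ (fun _ : ℝ => (1 : ℝ)) s ≤ 1 := fun _ => ⟨zero_le_one, le_rfl⟩
  have hχL : ∀ γ' : ℝ, ∀ s t : ℝ, s ∈ Set.Icc (0 : ℝ) γ' → t ∈ Set.Icc (0 : ℝ) γ' →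
      |(fun _ : ℝ => (1 : ℝ)) s - (fun _ : ℝ => (1 : ℝ)) t| ≤ 0 * |s - t| := fun _ s t _ _ => by simp
  -- the modulus condition ε∕M ≤ C
  have hεM : ε / M ≤ C := by
    have hMge : (n : ℝ) * (ε * n / (2 * (x₀ + ε * n) * Real.sqrt (x₀ + ε * n))) ≤ M := by
      rw [hM]; exact M_ge hA hB hb.le hε0.le hx
    have hdc : 2 * (x₀ + ε * n) * Real.sqrt (x₀ + ε * n) ≤ C * (n : ℝ) ^ 2 := by
      rw [hx₀]; exact depth_choice hb.le hC hg (mul_nonneg hε0.le hn0.le) hΔ1 hn1 hng hnC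
    have hy0 : 0 < x₀ + ε * n := by positivity
    have hD : 0 < 2 * (x₀ + ε * n) * Real.sqrt (x₀ + ε * n) := by positivity
    rw [div_le_iff₀ hMpos]
    have h1 : ε * ((n : ℝ) * n) ≤ M * (2 * (x₀ + ε * n) * Real.sqrt (x₀ + ε * n)) := by
      have := mul_le_mul_of_nonneg_right hMge hD.le
      rwa [show (n : ℝ) * (ε * n / (2 * (x₀ + ε * n) * Real.sqrt (x₀ + ε * n))) * (2 * (x₀ + ε * n) * Real.sqrt (x₀ + ε * n))
        = ε * ((n : ℝ) * n) by field_simp] at this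
    have h2 : ε * ((n : ℝ) * n) ≤ (C * M) * ((n : ℝ) * n) := by nlinarith [h1, mul_le_mul_of_nonneg_left hdc hMpos.le]
    exact le_of_mul_le_mul_right h2 (by positivity)
  -- the end point is g
  have hend : gA (2 * n) = g := by
    rw [hA]; push_cast
    rw [hx₀, show 1 / g ^ 2 + b * (2 * (n : ℝ)) - b * (2 * (n : ℝ)) = (1 / g) ^ 2 by ring, Real.sqrt_sq (by positivity), one_div_one_div]
  refine ⟨β, fun j i => if n ≤ j ∧ j < 2 * n then (if i < n then ε / M else 0) + (if i = j then ε * 0 else 0) else 0, 2 * n, gA, gB,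
    fun γ' => betaLowerH_of_bumpFamily hβ hε0.le hMpos.le hχ γ',
    fun γ' => ?_, fun γ' => histLipschitz_of_bumpFamily hβ hε0.le hMpos hχ (hχL γ'),
    uniformModulus_of_bumpFamily hε0.le hMpos le_rfl hεM (by rw [mul_zero]; exact hC.le),
    fun γ' k => coordLipschitzAt_of_uniformModulus (histLipschitz_of_bumpFamily hβ hε0.le hMpos hχ (hχL γ'))
      (uniformModulus_of_bumpFamily hε0.le hMpos le_rfl hεM (by rw [mul_zero]; exact hC.le)) k,
    fun γ' => betaContH_of_bumpFamily (ε := ε) (M := M) (χ := fun _ : ℝ => (1 : ℝ)) hβ continuous_const γ', ?_, fun γ' => lastVar_const_of_bumpFamily (ε := ε) (M := M) hβ γ',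
    rgEqH_runA (ε := ε) (χ := fun _ : ℝ => (1 : ℝ)) hβ hA hb.le hx hM hMpos, rgEqH_runB (ε := ε) (M := M) (χ := fun _ : ℝ => (1 : ℝ)) hβ hB hb.le hε0.le hx (fun _ _ _ => rfl), ?_, ?_,
    hend, (runs_end_eq hA hB).symm.trans hend, runs_start_lt hA hB hb.le hε0 hx hn1', hgγ⟩
  · -- upper letter with amplitude a ≥ ε
    intro k v hv
    exact (betaUpperH_of_bumpFamily hβ hε0.le hMpos.le hχ γ' k v hv).trans (by linarith)
  · -- BetaPertH with constant Cp: the bump vanishes on boxes ]0, γ′] with γ′ ≤ gᴬ_0∕3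
    have hτ : 0 < gA 0 / 3 := div_pos (gA_pos hA hb.le hx (Nat.zero_le _)) (by norm_num)
    have hΔ54 : ε * n ≤ 5 / 4 * (x₀ - b * (2 * n)) := by
      have h1 : ε * n ≤ 1 / g ^ 2 := by
        calc ε * n ≤ 1 / (g ^ 2 * n) * n := mul_le_mul_of_nonneg_right hεg hn0.le
          _ = 1 / g ^ 2 := by field_simp
      have h2 : x₀ - b * (2 * n) = 1 / g ^ 2 := by rw [hx₀]; ring
      rw [h2]; linarith
    refine betaPertH_of_bumpFamily hβ hε0.le hMpos.le hχ hCp.le hτ hγ (fun γ' hγ' hγ'τ j p hj hp => ?_) ?_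
    · exact bump_zero_of_smallBox hM hMpos (twoThirds_runB hA hB hb.le hε0.le hx hΔ54 hγ'τ) (by omega) hp
    · -- ε ≤ Cp (gᴬ_0∕3)² = Cp∕(9x₀)
      have h0 : (gA 0 / 3) ^ 2 = 1 / (9 * x₀) := by
        rw [hA 0]; push_cast
        rw [mul_zero, sub_zero, div_pow, div_pow, one_pow, Real.sq_sqrt hx₀0.le]; ring
      rw [h0]
      calc ε ≤ Cp / (9 * x₀) := hεCp
        _ = Cp * (1 / (9 * x₀)) := by ring
  · intro i hi
    have := (runs_box hA hB hb.le hε0.le hx).1 i hi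
    exact ⟨this.1, this.2.trans hend.le⟩
  · intro i hi
    have := (runs_box hA hB hb.le hε0.le hx).2 i hi
    exact ⟨this.1, this.2.trans hend.le⟩

/-! ## §21 Headlines: the θ = 1 endpoint of §11 and the depth condition of §16 are not removable -/

/-- **§11 AT θ = 1 HAS A FALSE CONCLUSION ON A SETTING.**  There are a `Setting S` (only its β matters), a box γ > 0, constants C ≥ 0 and b > 0,
moduli Λ, a depth K and two coupling sequences g, g′ with: both solve (0.20) for S.β (`RGEqH`), both stay in ]0, γ], they are PINNED g_K = g′_K,
`HistLipschitz Λ γ S.β`, `FadingMemory C 1 Λ` (UNIFORM modulus), `BetaLowerH b γ S.β` — every hypothesis of #61e `runs_eq_of_fadingMemory` except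
θ < 1 and its smallness (which at θ = 1 reads C·U ≤ 0) — and moreover `BetaUpperH (b + b) γ S.β`, (C) `BetaContH γ S.β`, `BetaPertH S.β b`; and
yet g_0 ≠ g′_0.  No smallness of (C, γ, b, b′) met by SOME C > 0 repairs the θ = 1 endpoint: by `exists_twoRuns_uniformModulus` the constants are
free. [cite: Balaban1987RG1, Thm 2 p.259 («g₀ = g₀(ε, g)») with (0.20) p.256 and p.298] -/
theorem uniformModulus_twoRuns_setting {b C γ : ℝ} (hb : 0 < b) (hC : 0 < C) (hγ : 0 < γ) :
    ∃ (S : Setting) (Λ : ℕ → ℕ → ℝ) (K : ℕ) (g g' : ℕ → ℝ),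
      RGEqH K S.β g ∧ RGEqH K S.β g' ∧ (∀ i, i ≤ K → 0 < g i ∧ g i ≤ γ) ∧ (∀ i, i ≤ K → 0 < g' i ∧ g' i ≤ γ) ∧ g K = g' K ∧
      HistLipschitz Λ γ S.β ∧ FadingMemory C 1 Λ ∧ BetaLowerH b γ S.β ∧ BetaUpperH (b + b) γ S.β ∧ BetaContH γ S.β ∧ BetaPertH S.β b ∧
      g 0 ≠ g' 0 := by
  obtain ⟨β, Λ, K, gA, gB, hlo, hup, hL, hΛ, -, hcont, hpert, -, hrgA, hrgB, hboxA, hboxB, hendA, hendB, hlt, -⟩ :=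
    exists_twoRuns_uniformModulus hb hC hb hb hγ hγ le_rfl
  -- a Setting carrying β (every other field is junk: only S.β is read)
  exact ⟨⟨13, True, 1, fun P _ => P.g0, β, 1, 1, 1, fun _ => Unit, fun _ => (), fun _ _ => 0, fun _ _ _ => 0, fun _ _ _ => 0,
      fun _ _ _ => True, 1, 1, 1, fun _ => 1, fun _ _ => fun _ _ _ => 0, fun _ _ => fun _ _ _ => 0, 1, fun _ _ => True, 1, True,
      fun _ _ => 0, 1, 1, 1, 1⟩, Λ, K, gA, gB, hrgA, hrgB, hboxA, hboxB, hendA.trans hendB.symm, hL γ, hΛ, hlo γ, hup γ, hcont γ, hpert,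
    (ne_of_lt hlt).symm⟩

/-- **#62a's DEPTH CONDITION CANNOT BE DROPPED**: the statement of `…HistoryUniformDepth.runs_eq_of_uniformModulus` with its last hypothesis
`C·(γ + (2∕b)√(1∕γ² + bK)) < b` REMOVED — i.e. K-UNIFORM uniqueness under a uniform history modulus — is FALSE. [cite: Balaban1987RG1, Thm 2 p.259 («g₀ = g₀(ε, g)») with (0.20) p.256 and p.298] -/
theorem not_runs_eq_uniform_allDepths : ¬ (∀ (S : Setting) (γ C b : ℝ) (Λ : ℕ → ℕ → ℝ) (K : ℕ) (g g' : ℕ → ℝ),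
    0 ≤ C → 0 < γ → 0 < b → RGEqH K S.β g → RGEqH K S.β g' →
    (∀ i, i ≤ K → 0 < g i ∧ g i ≤ γ) → (∀ i, i ≤ K → 0 < g' i ∧ g' i ≤ γ) → g K = g' K →
    HistLipschitz Λ γ S.β → FadingMemory C 1 Λ → BetaLowerH b γ S.β → ∀ j, j ≤ K → g j = g' j) := by
  intro h
  obtain ⟨S, Λ, K, g, g', hrg, hrg', hbox, hbox', hpin, hL, hΛ, hlo, -, -, -, hne⟩ :=
    uniformModulus_twoRuns_setting one_pos one_pos one_pos
  exact hne (h S 1 1 1 Λ K g g' zero_le_one one_pos one_pos hrg hrg' hbox hbox' hpin hL hΛ hlo 0 (Nat.zero_le K))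

end

end Summit.QuantumFields.BalabanUV.Beta.EriceFlowEnclosureB12AsPrintedHistoryNonuniqueEnd
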